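import Mathlib.MeasureTheory.Measure.Prokhorov
import Mathlib.MeasureTheory.Measure.LevyProkhorovMetric
import Literature.Analysis.FluidPDE.DissipationAnomaly
import Literature.Analysis.FunctionSpaces.FlatTorusProofs
import Literature.Analysis.FunctionSpaces.TorusRieszFischerParam
import Literature.Analysis.FunctionSpaces.TorusSpectralWeakDerivative
import Literature.Analysis.FunctionSpaces.TorusTestFunctionProofs
import HarnessLib

/-!
# Anomalous dissipation — proofs (weak gradient, mass bound, compactness)

`Literature.Analysis.FluidPDE.DissipationAnomaly` records, as named facts, that a torus
Leray–Hopf solution has a jointly measurable weak gradient in `L²`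
(`Torus.IsLerayHopfOn.exists_hasWeakGradient`) and that the dissipation measure `ν |∇u|² dx dt`
built from it has total mass at most `½‖u₀‖² + ∫₀ᵀ∫ ⟪f, u⟫`
(`Torus.IsLerayHopfOn.exists_dissipationMeasure_univ_le`; Leray 1934, (5.2); on the torus
Robinson–Rodrigo–Sadowski 2016, Def. 4.9 / (4.17)).

This file proves the second from the first (the step the docstring of the fact describes:
Tonelli on `[0, T] × T^d` and the energy inequality from `0` at `t = T`):

* `Torus.eHomSobolevSeminorm_le_eSobolevNorm` — `|f|_{Ḣ^s} ≤ ‖f‖_{H^s}` for `0 ≤ s`;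
* `Torus.eGradNormSq_le` — `‖∇v‖₂² ≤ 4π² ‖v‖²_{H¹}` (spectral);
* `Torus.IsLerayHopfOn.lintegral_eGradNormSq_lt_top` — `∫₀ᵀ ‖∇u‖₂² < ∞` for Leray–Hopf `u`
  (from the field `memL2Sobolev`), so that the `toReal` in the energy inequality is honest;
* `Torus.dissipationMeasure_univ_eq` — the mass of `dissipationMeasure ν G T` is
  `ofReal ν · ∫_{[0,T]} ∫⁻ |G t|²` (Tonelli);
* `Torus.IsLerayHopfOn.exists_dissipationMeasure_univ_le_of_exists_hasWeakGradient` — the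
  reduction `exists_hasWeakGradient → exists_dissipationMeasure_univ_le`.

It then discharges the first, `Torus.IsLerayHopfOn.exists_hasWeakGradient_holds` (spectral
`L²_t H¹_x` ⇒ jointly measurable `L²` weak gradient with Parseval; Evans, §5.2.1, §5.9.2;
Robinson–Rodrigo–Sadowski 2016, §1.7.1: `‖∇u‖² = (2π)³ ∑ₖ |k|² |û_k|² = ‖u‖²_{Ḣ¹}` on `𝕋³`;
Grafakos, Prop. 3.2.7), assembling three sibling FunctionSpaces files:

* joint measurability of `uncurry u` on `(0, T) × T^d` from the space–time lift
  (`Torus.aestronglyMeasurable_uncurry_of_stLift_restrict`, `FlatTorusProofs`), whence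
  measurability of the slice coefficients `t ↦ 𝓕(uᵢ(t))(k)`
  (`Torus.aestronglyMeasurable_mFourierCoeff_slice`);
* the parametrised Riesz–Fischer theorem `Torus.exists_memLp_two_forall_mFourierCoeff_eq`
  (`TorusRieszFischerParam`), applied to the coefficients `2πi kⱼ 𝓕(uᵢ(t))(k)`, square summable
  in `(t, k)` by `Torus.tsum_enorm_sq_freq_mul_mFourierCoeff_le` and `lintegral_eGradNormSq_lt_top`;
* the slice-wise identification of `L²` functions with those coefficients as weak partial
  derivatives, with Parseval (`Torus.hasWeakPartialDeriv_of_mFourierCoeff`,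
  `Torus.lintegral_sum_enorm_sq_eq_eGradNormSq`, `TorusSpectralWeakDerivative`);

and closes with the one-liner `Torus.IsLerayHopfOn.exists_dissipationMeasure_univ_le_holds`.

Finally it discharges the compactness facts
`Torus.exists_subseq_isDissipationMeasureOf_of_isLerayHopfOn` and
`Torus.TendstoWeakStar.exists_subseq_isDissipationMeasureOf` (DiPerna–Majda 1987, §1;
Buckmaster–Vicol 2019, §8): the dissipation measures `ν_m |∇u_m|² dx dt` of an unforced
Leray–Hopf sequence with data of bounded energy are finite measures on `ℝ × T^d` carried by the
compact slab `[0, T] × T^d`, of mass `≤ ½‖u₀^m‖² ≤ C` (the mass bound just proved), so a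
subsequence converges weakly:

* `Literature.Analysis.FluidPDE.exists_subseq_tendsto_finiteMeasure_of_isCompact` — sequential Prokhorov compactness for
  finite measures of bounded mass carried by one compact set, on a separable metrisable space
  (masses converge along a subsequence; normalised measures are tight, Mathlib's
  `isCompact_closure_of_isTightMeasureSet`, and `ProbabilityMeasure E` is pseudo-metrisable by
  the Lévy–Prokhorov metric, whence a convergent subsequence; recombine);
* `Torus.exists_subseq_isDissipationMeasureOf_of_univ_le` — the same in the language of
  `IsDissipationMeasureOf`, for given weak gradients with uniformly bounded dissipation;
* `Torus.exists_subseq_isDissipationMeasureOf_of_isLerayHopfOn_holds` and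
  `Torus.TendstoWeakStar.exists_subseq_isDissipationMeasureOf_holds`.

It also discharges `Torus.HasWeakGradient.unique` (Evans 2010, §5.2.1: integrable weak
gradients are a.e. unique): `Torus.HasWeakGradient.unique_holds`, coordinatewise from the accepted
`Torus.HasWeakPartialDeriv.unique_holds` (`TorusTestFunctionProofs`) and the fact that a linear map
on `ℝ^d` is determined by its values on the standard basis — the third hypothesis (U) of
`Torus.IsDissipationMeasureOf.hasDuchonRobertDefect_of` (`DuchonRobertInviscidLimit`).

## References

* J. Leray, *Sur le mouvement d'un liquide visqueux emplissant l'espace*, Acta Math. 63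
  (1934), (5.2) (energy inequality).
* J. C. Robinson, J. L. Rodrigo, W. Sadowski, *The Three-Dimensional Navier–Stokes
  Equations*, CUP (2016), Def. 4.9, (4.16)–(4.17), p. 80 (Leray–Hopf weak solutions on `𝕋³`,
  energy inequality `½‖u(t)‖² + ν∫₀ᵗ‖∇u‖² ≤ ½‖u₀‖²`).
* R. J. DiPerna, A. J. Majda, Comm. Math. Phys. 108 (1987), §1 (dissipation measures).
* L. C. Evans, *Partial Differential Equations*, 2nd ed., GSM 19 (AMS 2010), §5.2.1 (weak
  derivatives), §5.9.2 (spaces involving time). [Evans2010]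
* J. C. Robinson, J. L. Rodrigo, W. Sadowski, op. cit., §1.7.1, (1.15)–(1.17), PDF pp. 30–31
  (`H¹(𝕋³)` through Fourier series, `‖∇u‖² = ‖u‖²_{Ḣ¹}`). [RobinsonRodrigoSadowski2016]
* L. Grafakos, *Classical Fourier Analysis*, 3rd ed., GTM 249 (2014), Prop. 3.2.7 (Plancherel /
  Riesz–Fischer on `Tⁿ`, PDF pp. 195–196). [Grafakos2014]
* R. J. DiPerna, A. J. Majda, *Oscillations and concentrations in weak solutions of the
  incompressible fluid equations*, Comm. Math. Phys. 108 (1987), 667–689: §1 (weak limits of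
  Leray–Hopf sequences, (1.4)–(1.5)), §4, proof of Thm. 4.1, (4.7)–(4.8), p. 683 (uniform mass
  bound (4.7); "weak-star compactness in `M⁺(Ω × βRⁿ)` and the Riesz representation theorem
  lead to the following assertion for an appropriate subsequence", (4.8A)). [DiPernaMajda1987]
* T. Buckmaster, V. Vicol, *Convex integration and phenomenologies in turbulence*, EMS Surv.
  Math. Sci. 6 (2019) (doi:10.4171/emss/34; arXiv:1901.09023): §2.1 (6)–(7)
  (`ε^ν = ν⟨|∇v^ν|²⟩ + ⟨D(v^ν)⟩`, Leray–Hopf sequences in the energy space), §8, last problem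
  (anomalous dissipation along `ν → 0`). [BuckmasterVicol2019]
* P. Billingsley, *Convergence of Probability Measures*, 2nd ed., Wiley (1999), Thm. 5.1
  (Prokhorov: tight ⇒ relatively compact) — in Mathlib as
  `isCompact_closure_of_isTightMeasureSet` (`Mathlib.MeasureTheory.Measure.Prokhorov`) with the
  Lévy–Prokhorov pseudo-metrisability instance `PseudoMetrizableSpace (ProbabilityMeasure X)`
  for separable `X` (`Mathlib.MeasureTheory.Measure.LevyProkhorovMetric`).
-/

noncomputable section

open MeasureTheory TopologicalSpace Set Function Filter Topology
open scoped InnerProductSpace RealInnerProductSpace ENNReal NNReal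

namespace Literature.Analysis.FluidPDE.Torus

variable {d : Type*} [Fintype d]

/-! ## Spectral comparisons -/

section Spectral

variable {F : Type*} [NormedAddCommGroup F] [NormedSpace ℂ F]

/-- The homogeneous seminorm is dominated by the inhomogeneous norm for nonnegative order:
`|f|_{Ḣ^s} ≤ ‖f‖_{H^s}` for `0 ≤ s`, termwise `|k|^{2s} ≤ ⟨k⟩^{2s}` (Bahouri–Chemin–Danchin,
§1.4; Grafakos, §3.3). [folklore] -/
theorem eHomSobolevSeminorm_le_eSobolevNorm {s : ℝ} (hs : 0 ≤ s) (f : UnitAddTorus d → F) :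
    FunctionSpaces.Torus.eHomSobolevSeminorm s f ≤ FunctionSpaces.Torus.eSobolevNorm s f := by
  unfold FunctionSpaces.Torus.eHomSobolevSeminorm FunctionSpaces.Torus.eSobolevNorm
  gcongr with k
  split_ifs with hk
  · exact bot_le
  · apply ENNReal.ofReal_le_ofReal
    have h0 : 0 ≤ 1 + FunctionSpaces.Torus.freqNormSq k := by linarith [FunctionSpaces.Torus.freqNormSq_nonneg k]
    rw [FunctionSpaces.Torus.sobolevWeight, ← Real.rpow_natCast, ← Real.rpow_mul h0]
    norm_num
    exact Real.rpow_le_rpow (FunctionSpaces.Torus.freqNormSq_nonneg k) (by linarith) hs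

end Spectral

/-- The spectral squared gradient norm is at most `4π²` times the squared `H¹` norm of the
complexified field: `‖∇v‖₂² = 4π² |v|²_{Ḣ¹} ≤ 4π² ‖v‖²_{H¹}` (Grafakos, Prop. 3.2.6 (8), §3.3). [folklore] -/
theorem eGradNormSq_le (v : UnitAddTorus d → EuclideanSpace ℝ d) :
    FunctionSpaces.Torus.eGradNormSq v ≤
      ENNReal.ofReal (4 * Real.pi ^ 2) * FunctionSpaces.Torus.eSobolevNorm 1 (FunctionSpaces.EuclideanSpace.complexify ∘ v) ^ 2 := by
  unfold FunctionSpaces.Torus.eGradNormSq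
  gcongr
  exact eHomSobolevSeminorm_le_eSobolevNorm zero_le_one _

variable {T ν : ℝ} {f u : ℝ → UnitAddTorus d → EuclideanSpace ℝ d}
  {u₀ : UnitAddTorus d → EuclideanSpace ℝ d}

/-- A torus Leray–Hopf solution has finite total spectral dissipation `∫₀ᵀ ‖∇u‖₂² < ∞`: the
field `memL2Sobolev` gives `∫₀ᵀ ‖u‖²_{H¹} < ∞`, and `‖∇u‖₂² ≤ 4π² ‖u‖²_{H¹}` (`eGradNormSq_le`)
(Temam, Ch. III Thm. 3.1: `u ∈ L²(0,T; V)`; Robinson–Rodrigo–Sadowski 2016, Def. 4.9). This is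
what makes the `toReal` in the energy inequalities `energy_ineq_zero` / `energy_ineq_ae` honest. [folklore] -/
theorem IsLerayHopfOn.lintegral_eGradNormSq_lt_top [DecidableEq d] (h : IsLerayHopfOn T ν f u₀ u) :
    ∫⁻ t in Ioo 0 T, FunctionSpaces.Torus.eGradNormSq (u t) < ∞ := by
  have h2 := h.memL2Sobolev.2
  unfold FunctionSpaces.Torus.eL2SobolevNorm at h2
  have h3 : ∫⁻ t in Ioo 0 T, FunctionSpaces.Torus.eSobolevNorm 1 (FunctionSpaces.EuclideanSpace.complexify ∘ u t) ^ 2 < ∞ := by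
    by_contra hc
    rw [not_lt, top_le_iff] at hc
    rw [hc, ENNReal.top_rpow_of_pos (by norm_num)] at h2
    exact lt_irrefl _ h2
  calc ∫⁻ t in Ioo 0 T, FunctionSpaces.Torus.eGradNormSq (u t)
      ≤ ∫⁻ t in Ioo 0 T, ENNReal.ofReal (4 * Real.pi ^ 2) *
          FunctionSpaces.Torus.eSobolevNorm 1 (FunctionSpaces.EuclideanSpace.complexify ∘ u t) ^ 2 :=
        lintegral_mono fun t => eGradNormSq_le (u t)
    _ = ENNReal.ofReal (4 * Real.pi ^ 2) *
          ∫⁻ t in Ioo 0 T, FunctionSpaces.Torus.eSobolevNorm 1 (FunctionSpaces.EuclideanSpace.complexify ∘ u t) ^ 2 :=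
        lintegral_const_mul' _ _ ENNReal.ofReal_ne_top
    _ < ∞ := ENNReal.mul_lt_top ENNReal.ofReal_lt_top h3

/-! ## The mass of the dissipation measure (Tonelli) -/

/-- The dissipation density `(t, x) ↦ |G t x|²` of a jointly a.e.-strongly measurable gradient
field is a.e.-measurable (in the standard basis it is `∑ᵢ ‖G t x eᵢ‖²`, `weakGradNormSq_eq_sum`,
and evaluation at `eᵢ` is continuous). [folklore] -/
theorem aemeasurable_weakGradNormSq_uncurry [DecidableEq d] {μ : Measure (ℝ × UnitAddTorus d)}
    {G : ℝ → UnitAddTorus d → EuclideanSpace ℝ d →L[ℝ] EuclideanSpace ℝ d}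
    (hG : AEStronglyMeasurable (uncurry G) μ) :
    AEMeasurable (fun z : ℝ × UnitAddTorus d => weakGradNormSq (G z.1) z.2) μ := by
  have heq : (fun z : ℝ × UnitAddTorus d => weakGradNormSq (G z.1) z.2) =
      fun z => ∑ i, ‖(uncurry G z) (EuclideanSpace.single i 1)‖ ^ 2 := by
    funext z
    rw [weakGradNormSq_eq_sum]
    rfl
  rw [heq]
  refine Finset.aemeasurable_fun_sum _ fun i _ => ?_
  exact ((ContinuousLinearMap.apply ℝ (EuclideanSpace ℝ d)
    (EuclideanSpace.single i (1 : ℝ))).continuous.comp_aestronglyMeasurable hG).norm.aemeasurable.pow_const 2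

/-- **Mass of the dissipation measure by Tonelli.** For `ν ≥ 0` and a jointly a.e.-strongly
measurable gradient field `G` on `[0, T] × T^d`, the total mass of `ν |G|² dx dt ⌊ [0,T] × T^d`
is `ofReal ν · ∫_{t ∈ [0,T]} ∫⁻ₓ |G t x|²` (Tonelli, `MeasureTheory.lintegral_prod`; DiPerna–Majda
1987, §1). [folklore] -/
theorem dissipationMeasure_univ_eq [DecidableEq d] (hν : 0 ≤ ν)
    {G : ℝ → UnitAddTorus d → EuclideanSpace ℝ d →L[ℝ] EuclideanSpace ℝ d}
    (hG : AEStronglyMeasurable (uncurry G) (volume.restrict (Icc 0 T ×ˢ univ))) :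
    dissipationMeasure ν G T univ =
      ENNReal.ofReal ν * ∫⁻ t in Icc 0 T, ∫⁻ x, ENNReal.ofReal (weakGradNormSq (G t) x) := by
  have hG' : AEStronglyMeasurable (uncurry G) ((volume.restrict (Icc 0 T)).prod volume) := by
    rwa [Measure.volume_eq_prod, ← Measure.prod_restrict, Measure.restrict_univ] at hG
  rw [dissipationMeasure, withDensity_apply _ MeasurableSet.univ, Measure.restrict_univ,
    Measure.volume_eq_prod, ← Measure.prod_restrict, Measure.restrict_univ,
    lintegral_prod _ (((aemeasurable_weakGradNormSq_uncurry hG').const_mul ν).ennreal_ofReal)]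
  simp_rw [ENNReal.ofReal_mul hν]
  rw [← lintegral_const_mul' _ _ ENNReal.ofReal_ne_top]
  refine lintegral_congr fun t => ?_
  rw [lintegral_const_mul' _ _ ENNReal.ofReal_ne_top]

/-! ## The reduction to `exists_hasWeakGradient` -/

/-- **`exists_hasWeakGradient` implies `exists_dissipationMeasure_univ_le`.** Given the jointly
measurable `L²` weak gradient `G` of a torus Leray–Hopf solution with
`∫⁻ |G t|² = eGradNormSq (u t)` for a.e. `t ∈ (0, T)` (the named fact
`IsLerayHopfOn.exists_hasWeakGradient`), the dissipation measure `ν |G|² dx dt ⌊ [0,T] × T^d` has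
mass `ofReal ν · ∫₀ᵀ eGradNormSq (u t) dt` (Tonelli, `dissipationMeasure_univ_eq`; `[0,T]` versus
`(0,T)` is immaterial for Lebesgue measure), which the energy inequality from `0` at `t = T`
(field `energy_ineq_zero`; Leray 1934, (5.2); Robinson–Rodrigo–Sadowski 2016, (4.17)) bounds by
`½‖u₀‖² + ∫₀ᵀ∫ ⟪f, u⟫ − ½‖u(T)‖² ≤ ½‖u₀‖² + ∫₀ᵀ∫ ⟪f, u⟫`; the `toReal` there is honest by
`IsLerayHopfOn.lintegral_eGradNormSq_lt_top`. [cite: Leray1934, (5.2)] -/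
theorem IsLerayHopfOn.exists_dissipationMeasure_univ_le_of_exists_hasWeakGradient
    (hG : IsLerayHopfOn.exists_hasWeakGradient (T := T) (ν := ν) (f := f) (u₀ := u₀) (u := u)) :
    IsLerayHopfOn.exists_dissipationMeasure_univ_le (T := T) (ν := ν) (f := f) (u₀ := u₀)
      (u := u) := by
  intro _ h hν hT
  obtain ⟨G, hGm, hGae⟩ := hG h
  refine ⟨G, hGm, hGae.mono fun t ht => ⟨ht.1, ht.2.1⟩, ?_⟩
  have hfin : ∫⁻ t in Ioo 0 T, FunctionSpaces.Torus.eGradNormSq (u t) < ∞ := h.lintegral_eGradNormSq_lt_top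
  have hE := h.energy_ineq_zero T ⟨hT, le_rfl⟩
  have hE' : ν * (∫⁻ τ in Ioo 0 T, FunctionSpaces.Torus.eGradNormSq (u τ)).toReal ≤
      FunctionSpaces.Torus.kineticEnergy u₀ + ∫ τ in (0 : ℝ)..T, ∫ x, ⟪f τ x, u τ x⟫ := by
    linarith [FunctionSpaces.Torus.kineticEnergy_nonneg (u T)]
  have hmass : dissipationMeasure ν G T univ =
      ENNReal.ofReal ν * ∫⁻ t in Ioo 0 T, FunctionSpaces.Torus.eGradNormSq (u t) := by
    rw [dissipationMeasure_univ_eq hν hGm, ← restrict_Ioo_eq_restrict_Icc]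
    congr 1
    refine lintegral_congr_ae (hGae.mono fun t ht => ?_)
    exact ht.2.2
  rw [hmass, ← ENNReal.ofReal_toReal hfin.ne, ← ENNReal.ofReal_mul hν]
  exact ENNReal.ofReal_le_ofReal hE'

/-! ## Spectral weak gradients of `L²_t H¹_x` fields: discharge of `exists_hasWeakGradient` -/

section SpectralGradient

open UnitAddTorus
open scoped ComplexConjugate

/-- **Measurability of slice Fourier coefficients in the parameter.** If `uncurry u` is jointly
a.e.-strongly measurable on `μ ⊗ dx`, then `t ↦ 𝓕(uᵢ(t))(k)` is a.e.-strongly measurable for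
`μ`: the coefficient is the fibre integral `∫ conj(e_k(x)) uᵢ(t, x) dx` of a jointly measurable
function (`Torus.mFourierCoeff_eq_integral_conj_mul`, Fubini measurability
`MeasureTheory.AEStronglyMeasurable.integral_prod_right'`). [folklore] -/
theorem aestronglyMeasurable_mFourierCoeff_slice {μ : Measure ℝ} [SFinite μ]
    (hu : AEStronglyMeasurable (uncurry u) (μ.prod volume)) (i : d) (k : d → ℤ) :
    AEStronglyMeasurable (fun t => mFourierCoeff (fun x => (u t x i : ℂ)) k) μ := by
  have hcont : Continuous fun v : EuclideanSpace ℝ d => ((v i : ℝ) : ℂ) :=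
    Complex.continuous_ofReal.comp (EuclideanSpace.proj (𝕜 := ℝ) i).continuous
  have hF : AEStronglyMeasurable
      (fun z : ℝ × UnitAddTorus d => conj (mFourier k z.2) * ((u z.1 z.2 i : ℝ) : ℂ))
      (μ.prod volume) :=
    (Complex.continuous_conj.comp_aestronglyMeasurable
      (mFourier k).continuous.aestronglyMeasurable.comp_snd).mul (hcont.comp_aestronglyMeasurable hu)
  simp_rw [FunctionSpaces.Torus.mFourierCoeff_eq_integral_conj_mul]
  exact hF.integral_prod_right'

/-- **One entry of the spectral gradient is dominated by the spectral dissipation**: for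
integrable `v : T^d → ℝ^d` and indices `i, j`,
`∑ₖ ‖2πi kⱼ 𝓕(vᵢ)(k)‖² ≤ 4π² ∑ₖ |k|² ‖𝓕(complexify ∘ v)(k)‖² = eGradNormSq v`
(termwise `kⱼ² ≤ |k|²` and `|𝓕(vᵢ)(k)|² ≤ ‖𝓕(complexify ∘ v)(k)‖²`, `Torus.mFourierCoeff_complexify_apply`;
Robinson–Rodrigo–Sadowski 2016, §1.7.1, `‖∂ⱼu‖² ≤ ‖∇u‖² = ∑ₖ |k|²|û_k|²`). [folklore] -/
theorem tsum_enorm_sq_freq_mul_mFourierCoeff_le {v : UnitAddTorus d → EuclideanSpace ℝ d}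
    (hv : Integrable v volume) (i j : d) :
    ∑' k : d → ℤ, ‖(2 * Real.pi * Complex.I * (k j) : ℂ) *
        mFourierCoeff (fun x => (v x i : ℂ)) k‖ₑ ^ 2 ≤ FunctionSpaces.Torus.eGradNormSq v := by
  rw [FunctionSpaces.Torus.eGradNormSq_eq_tsum, ← ENNReal.tsum_mul_left]
  refine ENNReal.tsum_le_tsum fun k => ?_
  rw [enorm_mul, mul_pow, FunctionSpaces.enorm_sq_two_pi_I_mul, mul_assoc]
  refine mul_le_mul' le_rfl (mul_le_mul' ?_ ?_)
  · refine ENNReal.ofReal_le_ofReal ?_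
    unfold FunctionSpaces.Torus.freqNormSq
    exact Finset.single_le_sum (f := fun l : d => ((k l : ℤ) : ℝ) ^ 2) (fun _ _ => sq_nonneg _)
      (Finset.mem_univ j)
  · rw [FunctionSpaces.Torus.enorm_sq_eq_sum_euclidean, ← FunctionSpaces.Torus.mFourierCoeff_complexify_apply hv k i]
    exact Finset.single_le_sum
      (f := fun l : d => ‖(mFourierCoeff (FunctionSpaces.EuclideanSpace.complexify ∘ v) k) l‖ₑ ^ 2)
      (fun _ _ => zero_le) (Finset.mem_univ i)

/-- The matrix field with entries `a i j` (`i` = component, `j` = direction), assembled from the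
matrix units `E_{ji} w = wⱼ eᵢ`, acts on the basis vector `e_{j₀}` as the column
`∑ᵢ a i j₀ eᵢ`. [folklore] -/
theorem sum_smul_smulRight_apply_single [DecidableEq d] (a : d → d → ℝ) (j₀ : d) :
    (∑ i, ∑ j, a i j • (EuclideanSpace.proj j : EuclideanSpace ℝ d →L[ℝ] ℝ).smulRight
        (EuclideanSpace.single i (1 : ℝ))) (EuclideanSpace.single j₀ (1 : ℝ)) =
      ∑ i, a i j₀ • EuclideanSpace.single i (1 : ℝ) := by
  ext i'
  simp [Finset.sum_apply, Pi.single_apply]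

/-- `‖∑ᵢ aᵢ eᵢ‖² = ∑ᵢ aᵢ²` in `ℝ^d` (`EuclideanSpace.norm_sq_eq`). [folklore] -/
theorem norm_sq_sum_smul_single [DecidableEq d] (a : d → ℝ) :
    ‖∑ i, a i • EuclideanSpace.single i (1 : ℝ)‖ ^ 2 = ∑ i, a i ^ 2 := by
  rw [EuclideanSpace.norm_sq_eq]
  refine Finset.sum_congr rfl fun i _ => ?_
  simp [Finset.sum_apply, Pi.single_apply]

/-- The matrix field `x ↦ ∑ᵢⱼ aᵢⱼ(x) • E_{ji}` is a.e.-strongly measurable when its entries are. [folklore] -/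
theorem aestronglyMeasurable_sum_smul_smulRight [DecidableEq d] {α : Type*} [MeasurableSpace α]
    {μ : Measure α} {a : d → d → α → ℝ} (ha : ∀ i j, AEStronglyMeasurable (a i j) μ) :
    AEStronglyMeasurable (fun x => ∑ i, ∑ j, a i j x •
      (EuclideanSpace.proj j : EuclideanSpace ℝ d →L[ℝ] ℝ).smulRight
        (EuclideanSpace.single i (1 : ℝ))) μ :=
  Finset.aestronglyMeasurable_fun_sum _ fun i _ =>
    Finset.aestronglyMeasurable_fun_sum _ fun j _ => (ha i j).smul_const _

/-- The matrix field `x ↦ ∑ᵢⱼ aᵢⱼ(x) • E_{ji}` is integrable when its entries are. [folklore] -/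
theorem integrable_sum_smul_smulRight [DecidableEq d] {α : Type*} [MeasurableSpace α]
    {μ : Measure α} {a : d → d → α → ℝ} (ha : ∀ i j, Integrable (a i j) μ) :
    Integrable (fun x => ∑ i, ∑ j, a i j x •
      (EuclideanSpace.proj j : EuclideanSpace ℝ d →L[ℝ] ℝ).smulRight
        (EuclideanSpace.single i (1 : ℝ))) μ := by
  set E : d → d → (EuclideanSpace ℝ d →L[ℝ] EuclideanSpace ℝ d) := fun i j =>
    (EuclideanSpace.proj j : EuclideanSpace ℝ d →L[ℝ] ℝ).smulRight
      (EuclideanSpace.single i (1 : ℝ)) with hE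
  have h1 : ∀ i, Integrable (fun x => ∑ j, a i j x • E i j) μ := fun i =>
    integrable_finsetSum (μ := μ) Finset.univ (f := fun j x => a i j x • E i j)
      fun j _ => (ha i j).smul_const (E i j)
  exact integrable_finsetSum (μ := μ) Finset.univ (f := fun i x => ∑ j, a i j x • E i j)
    fun i _ => h1 i

/-- **Discharge of `Torus.IsLerayHopfOn.exists_hasWeakGradient`: Leray–Hopf solutions on the
torus have jointly measurable weak gradients in `L²` with Parseval.**

Sources: the fact (cited to Evans 2010, §5.9.2, spaces involving time; §5.2.1, weak
derivatives) is the torus form of the Fourier description of `H¹`: Robinson–Rodrigo–Sadowski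
2016, §1.7.1, PDF pp. 30–31 — on `𝕋³`, `∂ⱼ e^{ik·x} = i kⱼ e^{ik·x}` gives
`‖∇u‖² = ∑ⱼ ‖∂ⱼu‖² = (2π)³ ∑ₖ |k|² |û_k|² = ‖u‖²_{Ḣ¹}` with `û_k = conj û_{-k}` for real `u`
((1.15)–(1.17)); here with characters `e^{2πi k·x}` (constant `4π²`, `Torus.eGradNormSq`),
Plancherel / Riesz–Fischer on `Tⁿ` being Grafakos 2014, Prop. 3.2.7 (PDF pp. 195–196) and
`𝓕(∂ⱼφ)(m) = 2πi mⱼ φ̂(m)` Grafakos 2014, Prop. 3.1.2 (10) (PDF p. 188).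

Proof. Let `μ = dt ⌊ (0, T)` (a finite measure). (1) `uncurry u` is jointly measurable on
`μ ⊗ dx` (field `weak`, first conjunct, transferred from the space–time lift by
`Torus.aestronglyMeasurable_uncurry_of_stLift_restrict`), so each slice coefficient
`t ↦ 𝓕(uᵢ(t))(k)` is measurable (`aestronglyMeasurable_mFourierCoeff_slice`). (2) The candidate
coefficients `c i j (t, k) = 2πi kⱼ 𝓕(uᵢ(t))(k)` satisfy `∑ₖ ‖c i j (t, k)‖² ≤ eGradNormSq (u t)`
(`tsum_enorm_sq_freq_mul_mFourierCoeff_le`), whose time integral is finite by the field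
`memL2Sobolev` (`IsLerayHopfOn.lintegral_eGradNormSq_lt_top`). (3) The parametrised Riesz–Fischer
theorem `Torus.exists_memLp_two_forall_mFourierCoeff_eq` yields jointly measurable
`g i j : ℝ → T^d → ℂ` with `g i j t ∈ L²` and `𝓕(g i j t)(k) = c i j (t, k)` for a.e. `t`.
(4) For such `t` (and `u t ∈ L²`, field `memLp`), `x ↦ ∑ᵢ Re (g i j t x) eᵢ` is a weak `j`-th
partial derivative of `u t` (`Torus.hasWeakPartialDeriv_of_mFourierCoeff`), the `g i j t` are
a.e. real (`Torus.re_sq_ae_eq_norm_sq_of_mFourierCoeff`) and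
`∫ ∑ᵢⱼ ‖g i j t‖² = eGradNormSq (u t)` (`Torus.lintegral_sum_enorm_sq_eq_eGradNormSq`). The weak
gradient is the matrix field `G t x = ∑ᵢⱼ Re (g i j t x) • E_{ji}` (`E_{ji} w = wⱼ eᵢ`), jointly
measurable on `[0, T] × T^d` (`{0, T} × T^d` is null, `restrict_Ioo_eq_restrict_Icc`). [cite: Evans2010, §5.9.2] -/
theorem IsLerayHopfOn.exists_hasWeakGradient_holds :
    IsLerayHopfOn.exists_hasWeakGradient (T := T) (ν := ν) (f := f) (u₀ := u₀) (u := u) := by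
  intro _ h
  -- the parameter measure `dt ⌊ (0, T)`
  set μ : Measure ℝ := volume.restrict (Ioo 0 T) with hμ
  -- (1) joint measurability of `u` on `(0, T) × T^d`
  have hU : AEStronglyMeasurable (uncurry u) (μ.prod volume) := by
    have h1 := FunctionSpaces.Torus.aestronglyMeasurable_uncurry_of_stLift_restrict h.weak.1
    rwa [Measure.volume_eq_prod, ← Measure.prod_restrict, Measure.restrict_univ] at h1
  -- slices are in `L²` for every `t ∈ [0, T]`, in particular for a.e. `t ∈ (0, T)`
  have hLp : ∀ᵐ t ∂μ, MemLp (u t) 2 volume :=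
    (ae_restrict_iff' measurableSet_Ioo).2
      (ae_of_all _ fun t ht => h.memLp t (Ioo_subset_Icc_self ht))
  -- (2) the candidate coefficients of `∂ⱼ uᵢ`
  set c : d → d → ℝ → (d → ℤ) → ℂ := fun i j t k =>
    (2 * Real.pi * Complex.I * (k j) : ℂ) * mFourierCoeff (fun x => (u t x i : ℂ)) k with hc_def
  have hc : ∀ i j k, AEStronglyMeasurable (fun t => c i j t k) μ := fun i j k =>
    aestronglyMeasurable_const.mul (aestronglyMeasurable_mFourierCoeff_slice hU i k)
  have hC : ∀ i j, ∫⁻ t, ∑' k, ‖c i j t k‖ₑ ^ 2 ∂μ ≠ ∞ := by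
    intro i j
    refine ne_top_of_le_ne_top h.lintegral_eGradNormSq_lt_top.ne ?_
    refine lintegral_mono_ae (hLp.mono fun t ht => ?_)
    exact tsum_enorm_sq_freq_mul_mFourierCoeff_le (ht.integrable one_le_two) i j
  -- (3) Riesz–Fischer with the parameter `t`
  choose g hgm hg using fun i j => FunctionSpaces.Torus.exists_memLp_two_forall_mFourierCoeff_eq (hc i j) (hC i j)
  -- (4) the gradient field `G t x = ∑ᵢⱼ Re (g i j t x) • E_{ji}`
  refine ⟨fun t x => ∑ i, ∑ j, (g i j t x).re •
    (EuclideanSpace.proj j : EuclideanSpace ℝ d →L[ℝ] ℝ).smulRight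
      (EuclideanSpace.single i (1 : ℝ)), ?_, ?_⟩
  · -- joint measurability on `[0, T] × T^d`
    have hmeas : AEStronglyMeasurable (fun z : ℝ × UnitAddTorus d => ∑ i, ∑ j, (g i j z.1 z.2).re •
        (EuclideanSpace.proj j : EuclideanSpace ℝ d →L[ℝ] ℝ).smulRight
          (EuclideanSpace.single i (1 : ℝ))) (μ.prod volume) :=
      aestronglyMeasurable_sum_smul_smulRight fun i j =>
        Complex.continuous_re.comp_aestronglyMeasurable (hgm i j)
    rw [Measure.volume_eq_prod, ← Measure.prod_restrict, Measure.restrict_univ,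
      ← restrict_Ioo_eq_restrict_Icc]
    exact hmeas
  · -- the a.e. properties of the slices
    have hg' : ∀ᵐ t ∂μ, ∀ i j, MemLp (g i j t) 2 volume ∧
        ∀ k, mFourierCoeff (g i j t) k = c i j t k :=
      ae_all_iff.2 fun i => ae_all_iff.2 fun j => hg i j
    filter_upwards [hLp, hg'] with t hut hgt
    have hcoeff : ∀ i j (k : d → ℤ), mFourierCoeff (g i j t) k =
        (2 * Real.pi * Complex.I * (k j) : ℂ) * mFourierCoeff (fun x => (u t x i : ℂ)) k :=
      fun i j k => (hgt i j).2 k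
    refine ⟨fun j => ?_, ?_, ?_⟩
    · -- weak `j`-th partial derivative
      have hfun : (fun x => (∑ i, ∑ j', (g i j' t x).re •
          (EuclideanSpace.proj j' : EuclideanSpace ℝ d →L[ℝ] ℝ).smulRight
            (EuclideanSpace.single i (1 : ℝ))) (EuclideanSpace.single j (1 : ℝ))) =
          fun x => ∑ i, (g i j t x).re • EuclideanSpace.single i (1 : ℝ) :=
        funext fun x => sum_smul_smulRight_apply_single (fun i j' => (g i j' t x).re) j
      rw [hfun]
      exact FunctionSpaces.Torus.hasWeakPartialDeriv_of_mFourierCoeff hut (fun i => (hgt i j).1) j (fun i k => hcoeff i j k)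
    · -- integrability
      exact integrable_sum_smul_smulRight fun i j =>
        (Complex.reCLM.comp_memLp' (hgt i j).1).integrable one_le_two
    · -- Parseval: `∫⁻ |G t|² = eGradNormSq (u t)`
      have hre : ∀ᵐ x ∂volume, ∀ i j, (g i j t x).re ^ 2 = ‖g i j t x‖ ^ 2 :=
        ae_all_iff.2 fun i => ae_all_iff.2 fun j =>
          FunctionSpaces.Torus.re_sq_ae_eq_norm_sq_of_mFourierCoeff (hut.eval_piLp i) (hgt i j).1 j (hcoeff i j)
      rw [← FunctionSpaces.Torus.lintegral_sum_enorm_sq_eq_eGradNormSq hut (fun i j => (hgt i j).1) hcoeff]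
      refine lintegral_congr_ae (hre.mono fun x hx => ?_)
      dsimp only
      rw [weakGradNormSq_eq_sum]
      simp_rw [sum_smul_smulRight_apply_single, norm_sq_sum_smul_single]
      rw [Finset.sum_comm, ENNReal.ofReal_sum_of_nonneg fun i _ =>
        Finset.sum_nonneg fun j _ => sq_nonneg _]
      refine Finset.sum_congr rfl fun i _ => ?_
      rw [ENNReal.ofReal_sum_of_nonneg fun j _ => sq_nonneg _]
      refine Finset.sum_congr rfl fun j _ => ?_
      rw [hx i j, ← ofReal_norm, ENNReal.ofReal_pow (norm_nonneg _)]

/-- **Discharge of `Torus.IsLerayHopfOn.exists_dissipationMeasure_univ_le`** (Leray 1934, (5.2);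
Robinson–Rodrigo–Sadowski 2016, (4.17)): the reduction
`IsLerayHopfOn.exists_dissipationMeasure_univ_le_of_exists_hasWeakGradient` fed with
`IsLerayHopfOn.exists_hasWeakGradient_holds`. [cite: Leray1934, (5.2)] -/
theorem IsLerayHopfOn.exists_dissipationMeasure_univ_le_holds :
    IsLerayHopfOn.exists_dissipationMeasure_univ_le (T := T) (ν := ν) (f := f) (u₀ := u₀)
      (u := u) :=
  IsLerayHopfOn.exists_dissipationMeasure_univ_le_of_exists_hasWeakGradient
    IsLerayHopfOn.exists_hasWeakGradient_holds

end SpectralGradient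

end Literature.Analysis.FluidPDE.Torus

/-! ## Compactness of dissipation measures: discharge of
`TendstoWeakStar.exists_subseq_isDissipationMeasureOf` -/

namespace Literature.Analysis.FluidPDE

section Prokhorov

variable {E : Type*} [MeasurableSpace E] [TopologicalSpace E]

/-- **Sequential Prokhorov compactness for finite measures carried by a fixed compact set.**
On a separable (pseudo)metrisable Borel space `E`, a sequence of finite Borel measures of
mass at most `C`, all carried by one compact set `K`, has a weakly convergent subsequence
(convergence in `FiniteMeasure E`, i.e. against bounded continuous functions). Proof: the
masses converge along a subsequence (compactness of `[0, C]`); if the limit is `0` the measures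
tend to `0` (`FiniteMeasure.tendsto_zero_of_tendsto_zero_mass`); otherwise, discarding the
finitely many zero measures, the normalised probability measures are carried by `K`, hence
tight, so their closure is compact (Mathlib's Prokhorov theorem
`isCompact_closure_of_isTightMeasureSet`) and — `ProbabilityMeasure E` being pseudo-metrisable
by the Lévy–Prokhorov metric — sequentially compact; finally
`∫ g dμₙ = massₙ · ∫ g d(normalize μₙ)` recombines the two limits (Billingsley, *Convergence of
Probability Measures*, 2nd ed., Thm. 5.1 (Prokhorov); DiPerna–Majda 1987, §4, proof of Thm. 4.1:
"weak-star compactness in `M⁺`"). Not in Mathlib in sequential form for `FiniteMeasure`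
(searched `IsSeqCompact`, `FirstCountableTopology (FiniteMeasure`, `tendsto_subseq` in
`MeasureTheory.Measure`: none).
[cite: DiPernaMajda1987, §4, proof of Thm. 4.1, (4.7)–(4.8), p. 683] -/
theorem exists_subseq_tendsto_finiteMeasure_of_isCompact [PseudoMetrizableSpace E]
    [SeparableSpace E] [T2Space E] [BorelSpace E] [Nonempty E]
    {K : Set E} (hK : IsCompact K) {C : ℝ≥0} (μ : ℕ → FiniteMeasure E)
    (hC : ∀ n, (μ n).mass ≤ C) (hμK : ∀ n, μ n Kᶜ = 0) :
    ∃ φ : ℕ → ℕ, StrictMono φ ∧ ∃ ν : FiniteMeasure E, Tendsto (μ ∘ φ) atTop (𝓝 ν) := by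
  -- Step 1: the masses converge along a subsequence `φ₁`, to some `c ∈ [0, C]`
  obtain ⟨c, -, φ₁, hφ₁, hc⟩ := (isCompact_Icc (a := (0 : ℝ≥0)) (b := C)).tendsto_subseq
    (x := fun n => (μ n).mass) fun n => ⟨bot_le, hC n⟩
  by_cases hc0 : c = 0
  · -- `c = 0`: the measures themselves go to zero
    subst hc0
    exact ⟨φ₁, hφ₁, 0, FiniteMeasure.tendsto_zero_of_tendsto_zero_mass hc⟩
  -- Step 2 (`c ≠ 0`): discard the finitely many zero measures ...
  obtain ⟨φ₂, hφ₂, hne⟩ := extraction_of_eventually_atTop (hc.eventually_ne hc0)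
  have hne' : ∀ n, μ (φ₁ (φ₂ n)) ≠ 0 := fun n => (FiniteMeasure.mass_nonzero_iff _).1 (hne n)
  -- ... and normalise: probability measures carried by `K`, a tight family
  set P : ℕ → ProbabilityMeasure E := fun n => (μ (φ₁ (φ₂ n))).normalize with hP
  have hP0 : ∀ n, (P n : Measure E) Kᶜ = 0 := by
    intro n
    rw [hP, FiniteMeasure.toMeasure_normalize_eq_of_nonzero _ (hne' n), Measure.smul_apply,
      (FiniteMeasure.null_iff_toMeasure_null _ _).1 (hμK _), smul_zero]
  have htight : IsTightMeasureSet {((Q : ProbabilityMeasure E) : Measure E) | Q ∈ range P} := by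
    rw [isTightMeasureSet_iff_exists_isCompact_measure_compl_le]
    intro ε hε
    refine ⟨K, hK, ?_⟩
    rintro _ ⟨Q, ⟨n, rfl⟩, rfl⟩
    simp [hP0 n]
  -- Step 3: Prokhorov (compact closure of a tight family) and pseudo-metrisability of
  -- `ProbabilityMeasure E` (Lévy–Prokhorov) give a weakly convergent subsequence
  obtain ⟨Q, -, ψ, hψ, hQ⟩ := (isCompact_closure_of_isTightMeasureSet htight).tendsto_subseq
    (x := P) fun n => subset_closure (mem_range_self n)
  -- Step 4: recombine masses and normalised measures
  refine ⟨φ₁ ∘ φ₂ ∘ ψ, hφ₁.comp (hφ₂.comp hψ), c • Q.toFiniteMeasure, ?_⟩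
  rw [FiniteMeasure.tendsto_iff_forall_integral_tendsto]
  intro g
  have h1 : ∀ n, ∫ x, g x ∂(μ n : Measure E) =
      (μ n).mass • ∫ x, g x ∂((μ n).normalize : Measure E) := by
    intro n
    conv_lhs => rw [(μ n).self_eq_mass_smul_normalize]
    rw [FiniteMeasure.toMeasure_smul, integral_smul_nnreal_measure]
    rfl
  have h2 : ∫ x, g x ∂((c • Q.toFiniteMeasure : FiniteMeasure E) : Measure E) =
      c • ∫ x, g x ∂(Q : Measure E) := by
    rw [FiniteMeasure.toMeasure_smul, integral_smul_nnreal_measure]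
    rfl
  simp_rw [comp_apply, h1, h2]
  exact ((hc.comp hφ₂.tendsto_atTop).comp hψ.tendsto_atTop).smul
    ((ProbabilityMeasure.tendsto_iff_forall_integral_tendsto.1 hQ) g)

end Prokhorov

namespace Torus

variable {d : Type*} [Fintype d] {T : ℝ} {u : ℝ → UnitAddTorus d → EuclideanSpace ℝ d}

/-- The dissipation measure `ν |G|² dx dt ⌊ [0,T] × T^d` is carried by `[0, T] × T^d`: it is
absolutely continuous with respect to Lebesgue measure restricted there
(`MeasureTheory.withDensity_absolutelyContinuous`). [folklore] -/
theorem dissipationMeasure_compl_prod_univ (ν : ℝ)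
    (G : ℝ → UnitAddTorus d → EuclideanSpace ℝ d →L[ℝ] EuclideanSpace ℝ d) (T : ℝ) :
    dissipationMeasure ν G T (Icc 0 T ×ˢ univ)ᶜ = 0 := by
  refine withDensity_absolutelyContinuous _ _ ?_
  rw [Measure.restrict_apply (measurableSet_Icc.prod MeasurableSet.univ).compl,
    compl_inter_self, measure_empty]

/-- For `T < 0` the slab `[0, T] × T^d` is empty and the dissipation measure vanishes. [folklore] -/
theorem dissipationMeasure_of_neg {ν : ℝ}
    (G : ℝ → UnitAddTorus d → EuclideanSpace ℝ d →L[ℝ] EuclideanSpace ℝ d) (hT : T < 0) :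
    dissipationMeasure ν G T = 0 := by
  rw [dissipationMeasure, Icc_eq_empty (not_le.2 hT), empty_prod, Measure.restrict_empty,
    withDensity_zero_left]

/-- **The Prokhorov step for dissipation measures.** Given, for each `m`, a jointly
a.e.-strongly measurable field `G_m` on `[0, T] × T^d` whose slices are integrable weak
gradients of `u_m t` for a.e. `t ∈ (0, T)`, with dissipation measures `ν_m |G_m|² dx dt` of
total mass at most `C` uniformly in `m`, some subsequence has a limiting dissipation measure
`D` (`IsDissipationMeasureOf`): the measures are finite, carried by the compact
`[0, T] × T^d` (`dissipationMeasure_compl_prod_univ`), so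
`exists_subseq_tendsto_finiteMeasure_of_isCompact` applies on the separable metrisable space
`ℝ × T^d` (DiPerna–Majda 1987, §1 and §4, proof of Thm. 4.1, weak-star compactness in `M⁺`;
Buckmaster–Vicol 2019, §2.1 (6)–(7) and §8, the dissipation `ν|∇v^ν|²` of Leray–Hopf
sequences). [cite: DiPernaMajda1987, §4, proof of Thm. 4.1, (4.7)–(4.8), p. 683] -/
theorem exists_subseq_isDissipationMeasureOf_of_univ_le [DecidableEq d] {νseq : ℕ → ℝ}
    {useq : ℕ → ℝ → UnitAddTorus d → EuclideanSpace ℝ d}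
    (G : ℕ → ℝ → UnitAddTorus d → EuclideanSpace ℝ d →L[ℝ] EuclideanSpace ℝ d)
    (hGm : ∀ m, AEStronglyMeasurable (uncurry (G m)) (volume.restrict (Icc 0 T ×ˢ univ)))
    (hGae : ∀ m, ∀ᵐ t ∂(volume.restrict (Ioo 0 T)),
      HasWeakGradient (useq m t) (G m t) ∧ Integrable (G m t) volume)
    {C : ℝ} (hle : ∀ m, dissipationMeasure (νseq m) (G m) T univ ≤ ENNReal.ofReal C) :
    ∃ φ : ℕ → ℕ, StrictMono φ ∧ ∃ D : Measure (ℝ × UnitAddTorus d),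
      IsDissipationMeasureOf (νseq ∘ φ) (useq ∘ φ) T D := by
  have hfin : ∀ m, IsFiniteMeasure (dissipationMeasure (νseq m) (G m) T) := fun m =>
    ⟨(hle m).trans_lt ENNReal.ofReal_lt_top⟩
  -- the dissipation measures as a sequence in `FiniteMeasure (ℝ × T^d)`
  set μ : ℕ → FiniteMeasure (ℝ × UnitAddTorus d) := fun m =>
    ⟨dissipationMeasure (νseq m) (G m) T, hfin m⟩ with hμ
  have hmass : ∀ m, (μ m).mass ≤ C.toNNReal := fun m =>
    ENNReal.coe_le_coe.1 (by rw [FiniteMeasure.ennreal_mass]; exact hle m)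
  have hK : IsCompact (Icc (0 : ℝ) T ×ˢ (univ : Set (UnitAddTorus d))) :=
    isCompact_Icc.prod isCompact_univ
  have hμK : ∀ m, μ m (Icc 0 T ×ˢ univ)ᶜ = 0 := fun m =>
    (FiniteMeasure.null_iff_toMeasure_null _ _).2 (dissipationMeasure_compl_prod_univ _ _ _)
  obtain ⟨φ, hφ, D, hD⟩ := exists_subseq_tendsto_finiteMeasure_of_isCompact hK μ hmass hμK
  refine ⟨φ, hφ, D, fun m => G (φ m), fun m => hGm (φ m), fun m => hGae (φ m),
    fun m => hfin (φ m), inferInstance, fun g => ?_⟩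
  exact (FiniteMeasure.tendsto_iff_forall_integral_tendsto.1 hD) g

/-- **Discharge of `Torus.exists_subseq_isDissipationMeasureOf_of_isLerayHopfOn`**
(DiPerna–Majda 1987, §1; Buckmaster–Vicol 2019, §8). For `T ≥ 0` the weak gradients and the
uniform mass bound `ν_m ∫∫|∇u_m|² ≤ ½‖u₀^m‖² ≤ C` (no force) come from
`IsLerayHopfOn.exists_dissipationMeasure_univ_le_holds` (energy inequality, Leray 1934, (5.2));
for `T < 0` the weak gradients come from `IsLerayHopfOn.exists_hasWeakGradient_holds` and all
dissipation measures vanish (`dissipationMeasure_of_neg`). Then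
`exists_subseq_isDissipationMeasureOf_of_univ_le` (Prokhorov). [cite: DiPernaMajda1987, §1] -/
theorem exists_subseq_isDissipationMeasureOf_of_isLerayHopfOn_holds :
    exists_subseq_isDissipationMeasureOf_of_isLerayHopfOn (d := d) (T := T) := by
  intro _ νseq useq u₀seq hν hLH hE
  obtain ⟨C, hC⟩ := hE
  by_cases hT : 0 ≤ T
  · choose G hGm hGae hle using fun m =>
      IsLerayHopfOn.exists_dissipationMeasure_univ_le_holds (hLH m) (hν m) hT
    refine exists_subseq_isDissipationMeasureOf_of_univ_le G hGm hGae (C := C) fun m => ?_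
    refine (hle m).trans (ENNReal.ofReal_le_ofReal ?_)
    simpa using hC m
  · choose G hGm hGae using fun m => IsLerayHopfOn.exists_hasWeakGradient_holds (hLH m)
    refine exists_subseq_isDissipationMeasureOf_of_univ_le G hGm
      (fun m => (hGae m).mono fun t ht => ⟨ht.1, ht.2.1⟩) (C := 0) fun m => ?_
    rw [dissipationMeasure_of_neg (G m) (not_le.1 hT)]
    exact bot_le

/-- **Discharge of `Torus.TendstoWeakStar.exists_subseq_isDissipationMeasureOf`**
(DiPerna–Majda 1987, §1, (1.4)–(1.5); Buckmaster–Vicol 2019, §8): the subsequence of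
`exists_subseq_isDissipationMeasureOf_of_isLerayHopfOn_holds` keeps the weak-* limit
(`TendstoWeakStar.comp`) — the interim proof, now closed. [cite: BuckmasterVicol2019, §8] -/
theorem TendstoWeakStar.exists_subseq_isDissipationMeasureOf_holds :
    TendstoWeakStar.exists_subseq_isDissipationMeasureOf (d := d) (T := T) (u := u) := by
  intro _ νseq useq u₀seq hconv hν hLH hE
  obtain ⟨φ, hφ, hD⟩ := exists_subseq_isDissipationMeasureOf_of_isLerayHopfOn_holds hν hLH hE
  exact ⟨φ, hφ, hconv.comp hφ, hD⟩

/-- **Discharge of `Torus.HasWeakGradient.unique`** (Evans 2010, §5.2.1, Lemma "uniqueness of weak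
derivatives"): two integrable weak gradients `G, G'` of the same field agree a.e. — in each
coordinate direction `eᵢ` the slices `x ↦ G x eᵢ`, `x ↦ G' x eᵢ` are integrable weak `i`-th partial
derivatives, hence a.e. equal (`Torus.HasWeakPartialDeriv.unique_holds`); intersecting the finitely
many full-measure sets, `G x` and `G' x` agree on the standard basis, hence are equal
(`Basis.ext`). [cite: Evans2010, §5.2.1 Lemma (Uniqueness of weak derivatives)] -/
theorem HasWeakGradient.unique_holds : HasWeakGradient.unique (d := d) := by
  intro _ v G G' hG hG' h h'
  have hi : ∀ i, (fun x => G x (EuclideanSpace.single i 1)) =ᵐ[volume]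
      fun x => G' x (EuclideanSpace.single i 1) := fun i =>
    FunctionSpaces.Torus.HasWeakPartialDeriv.unique_holds (EuclideanSpace ℝ d)
      (hG.apply_continuousLinearMap _) (hG'.apply_continuousLinearMap _) (h i) (h' i)
  filter_upwards [ae_all_iff.2 hi] with x hx
  have hlin : (G x : EuclideanSpace ℝ d →ₗ[ℝ] EuclideanSpace ℝ d) = G' x :=
    (EuclideanSpace.basisFun d ℝ).toBasis.ext fun i => by
      rw [OrthonormalBasis.coe_toBasis, EuclideanSpace.basisFun_apply, ContinuousLinearMap.coe_coe,
        ContinuousLinearMap.coe_coe]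
      exact hx i
  exact ContinuousLinearMap.coe_injective hlin

end Torus

end Literature.Analysis.FluidPDE
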